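import Summits.BirchSwinnertonDyer.BirchSwinnertonDyer.Theorems.ResidualThetaTransportAtTwoThetaLayerLambdaCongruenceAtTwoSdTwoInterface
import Summits.BirchSwinnertonDyer.BirchSwinnertonDyer.Theorems.ResidualThetaTransportAtTwoThetaLayerLambdaCongruenceAtTwoSdTorsionFrickeHeckeModule
import Summits.BirchSwinnertonDyer.BirchSwinnertonDyer.Theorems.ResidualThetaTransportAtTwoThetaLayerLambdaCongruenceAtTwoCrossingPairingHecke
import Summits.BirchSwinnertonDyer.BirchSwinnertonDyer.Theorems.ResidualThetaTransportAtTwoThetaLayerLambdaCongruenceAtTwoOfSdBz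
import Literature.NumberTheory.EllipticCurves.NewformsHeckeStableProofs
import Literature.NumberTheory.EllipticCurves.ModularJacobianTorsionHeckeSelfDualProofs
import HarnessLib

/-!
# Crux Kan⁺ `ThetaLayerLambdaCongruenceAtTwo` (stmt-BirchSwinnertonDyer-20688), line `birth` v14, SD floor — KERNEL-ROAD ASSEMBLY (brick S7
# + the operator identity `U_q† = w U_q w` ON `Λ`): the named fact IP from the TRANSPOSE-ADJOINTNESS of ONE perfect pairing on `Λ`
# (width seat bsd-wall-rtt-p3-w4 g7; `--supports stmt-BirchSwinnertonDyer-20688`; THEOREMS ONLY — no `def`, no named fact, no `sorry`)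

HONEST FRAMING. Nothing here settles Kan⁺ and BSD is not proved by any of this. Every statement is either a theorem about the tree's
objects or CONDITIONAL on its displayed hypotheses. What this file fixes, in the kernel, is the END of the SD kernel road
(`Cruxes/ThetaLayerLambdaCongruenceAtTwo/Lines/birth-sd2-architecture.md` v3 §7, `…/birth-sd2-hecke-adjoint.md` §1 (HA-W) + the IP tail of HA8):
the named fact IP = `periodHomology_exists_heckeSelfAdjoint_perfectPairing` («on `Λ = periodHomologyHecke N` there is a PERFECT
bi-additive `B` with EVERY `t ∈ 𝕋_ℤ` self-adjoint») follows from
  (P) ONE bi-additive `B : Λ → Hom(Λ, ℤ)` that is BIJECTIVE — a tree theorem (`exists_perfect_crossingPairing_hecke`, rtt-p3-w2 g8), and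
  (HA) its TRANSPOSE-ADJOINTNESS on the generators: `B (T_p • x) y = B x (T♯_p y)` for every prime `p`, where `T♯_p` is the dual action on
       `Λ` of the transposed double coset `[Γ₀(N) diag(p,1) Γ₀(N)]` — the one open brick (Merel 1995 §2; owner rtt-p3-w3 g11),
with NO case split `p ∤ N` / `q ∣ N`, NO commutation hypothesis `w T_p = T_p w`, and NO isometry `B(wx, wy) = B(x, y)`.

## Contents
* §1 (S6b ON `Λ`, all primes, weight 2): `dualMap_transposeHeckeT_eq_frickeConj` — `[Γ₀(N) diag(p,1) Γ₀(N)]^∨ = w_N^∨ ∘ T_p^∨ ∘ w_N^∨` on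
  `S₂(Γ₀(N))^∨` (the tree's `frickeInvolution_heckeT_frickeInvolution`, Diamond–Shurman Ex. 5.5.1, with `(-1)² = 1`); hence
  `dualMap_transposeHeckeT_mem_periodHomology` (`T♯_p` preserves `Λ`) and `frickeHom_heckeT_frickeHom_coe` (`w (T_p • (w y)) = T♯_p y` on `Λ`
  for w4 g6's `w = w_N^∨`, `exists_frickeHom_periodHomologyHecke`).
* §2 (S7, one level): `exists_perfect_balanced_of_twistedAdjoint` — `B` bijective, `w` an involution, `B (T_p • x) y = B x (w (T_p • (w y)))`
  for all primes ⟹ `B' := B(·, w ·)` is bijective and `𝕋_ℤ`-balanced (`balanced_of_balanced_T`, lead g12, over `ℤ`); the same with the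
  transposed operator spelled on the dual side (`exists_perfect_balanced_of_transposeAdjoint`, `w` supplied internally) and in the lead's split
  shapes `hT`/`hU`/`hTw` (`exists_perfect_balanced_of_adjoint_T_U`); per-level SD for every `ℓ` (`exists_selfDual_torsionBy_of_perfect_balanced`).
* §3 (all levels): `ip_of_transposeAdjoint`, `ip_of_twistedAdjoint`, `ip_of_crossingPairing_transposeAdjoint` (the hypothesis quantified over
  the pairings satisfying w2 g8's crossing formula, i.e. the literal output shape of bricks HA-T/HA-U) : IP BY NAME; then SD BY NAME
  (`heckeSelfDual_of_transposeAdjoint`, via `heckeSelfDual_torsionBy_J0_of_perfectPairing`) and **Kan⁺ ⟸ transpose-adjointness + Bz**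
  (`thetaLayerLambdaCongruenceAtTwo_of_transposeAdjoint_bz`, via `thetaLayerLambdaCongruenceAtTwo_of_ipBz`).

References: L. Merel, Homologie des courbes modulaires affines et paramétrisations modulaires (1995) §1.2–1.3, §2.1–2.3 [Merel1995Homologie];
F. Diamond, J. Shurman, A First Course in Modular Forms (2005) Ex. 5.5.1, Prop. 5.5.2 [DiamondShurman2005]; H. Darmon, F. Diamond, R. Taylor,
Fermat's Last Theorem (1995) §1.6 Lemma 1.38, §4.5 [DarmonDiamondTaylor1995]; A. O. L. Atkin, J. Lehner, Hecke operators on `Γ₀(m)` (1970)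
Lemmas 7, 11 [AtkinLehner1970]; K. Buzzard, On level-lowering for mod 2 representations, MRL 7 (2000) Prop. 2.4 [Buzzard2000LevelLoweringModTwo].
-/

set_option autoImplicit false
-- justification: the `Summit.BirchSwinnertonDyer.BirchSwinnertonDyer.…` path repeats a component (route-file convention)
set_option linter.dupNamespace false

noncomputable section

open scoped MatrixGroups ModularForm

open CongruenceSubgroup Matrix.SpecialLinearGroup ModularGroup
open Literature.NumberTheory.EllipticCurves Literature.NumberTheory.EllipticCurves.ModularForms
open Summit.BirchSwinnertonDyer.BirchSwinnertonDyer.Theses.ResidualThetaTransportAtTwo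

namespace Summit.BirchSwinnertonDyer.BirchSwinnertonDyer.Theorems.ThetaLayerLambdaCongruenceAtTwo

/-! ## §1 The transposed Hecke operator `T♯_p = [Γ₀(N) diag(p,1) Γ₀(N)]` on `S₂(Γ₀(N))^∨` and on `Λ`: `T♯_p = w U_p w` -/

section Transpose

variable (N : ℕ) [NeZero N]

/-- **`[Γ₀(N) diag(p,1) Γ₀(N)]^∨ = w_N^∨ ∘ T_p^∨ ∘ w_N^∨` on `S₂(Γ₀(N))^∨`** (weight `2`, every `p ≥ 1`): the dual of the tree's
`frickeInvolution_heckeT_frickeInvolution` (`w_N T_p w_N = (-1)^k [Γ₀(N) diag(p,1) Γ₀(N)]`, Diamond–Shurman Ex. 5.5.1) with `(-1)² = 1`.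
[cite: DiamondShurman2005, Ex. 5.5.1] -/
theorem dualMap_transposeHeckeT_eq_frickeConj (p : ℕ) [NeZero p] (φ : Module.Dual ℂ (CuspForm (Gamma0 N) 2)) :
    (cuspHeckeOperatorₗ (Gamma0 N) 2 (diagGL p 1 (Nat.cast_pos.mpr (NeZero.pos p)) one_pos)).dualMap φ =
      (frickeInvolution N 2).dualMap ((heckeT (Gamma0 N) 2 p).dualMap ((frickeInvolution N 2).dualMap φ)) := by
  ext g
  simp only [LinearMap.dualMap_apply]
  rw [frickeInvolution_heckeT_frickeInvolution N 2 p g, zpow_two, neg_one_mul, neg_neg, one_smul]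

/-- **`T♯_p = [Γ₀(N) diag(p,1) Γ₀(N)]^∨` preserves the period homology `Λ = H₁(X₀(N); ℤ)`** for every prime `p` (it is
`w_N^∨ T_p^∨ w_N^∨`, and `w_N^∨`, `T_p^∨` preserve `Λ`: `dualMap_frickeInvolution_mem_periodHomology`, `dualMap_heckeT_mem_periodHomology`).
[cite: Merel1995Homologie, §2.1–2.3] [cite: DiamondShurman2005, Ex. 5.5.1] -/
theorem dualMap_transposeHeckeT_mem_periodHomology (p : ℕ) (hp : p.Prime) {φ : Module.Dual ℂ (CuspForm (Gamma0 N) 2)}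
    (hφ : φ ∈ periodHomology N) :
    (haveI : NeZero p := ⟨hp.ne_zero⟩;
      (cuspHeckeOperatorₗ (Gamma0 N) 2 (diagGL p 1 (Nat.cast_pos.mpr (NeZero.pos p)) one_pos)).dualMap φ) ∈ periodHomology N := by
  haveI : NeZero p := ⟨hp.ne_zero⟩
  rw [dualMap_transposeHeckeT_eq_frickeConj]
  exact SdTorsion.dualMap_frickeInvolution_mem_periodHomology N
    (dualMap_heckeT_mem_periodHomology N hp (SdTorsion.dualMap_frickeInvolution_mem_periodHomology N hφ))

/-- **`w (T_p • (w y)) = T♯_p y` on `Λ = periodHomologyHecke N`, for every prime `p`** (no `p ∤ N` split): for any additive `w : Λ → Λ` whose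
underlying map is `w_N^∨` (w4 g6's `exists_frickeHom_periodHomologyHecke`), the functional underlying `w (T_p • (w y))` is
`[Γ₀(N) diag(p,1) Γ₀(N)]^∨ y` — `U_q† = w U_q w` as an identity on `Λ` (Agashe–Ribet–Stein §3 / Diamond–Im Rem. 10.2.2 shape).
[cite: DiamondShurman2005, Ex. 5.5.1] [cite: Merel1995Homologie, §2.3] -/
theorem frickeHom_heckeT_frickeHom_coe (w : periodHomologyHecke N →+ periodHomologyHecke N)
    (hw : ∀ x : periodHomologyHecke N,
      ((w x : periodHomologyHecke N) : Module.Dual ℂ (CuspForm (Gamma0 N) 2)) =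
        (frickeInvolution N 2).dualMap (x : Module.Dual ℂ (CuspForm (Gamma0 N) 2)))
    (p : ℕ) (hp : p.Prime) (y : periodHomologyHecke N) :
    ((w (HeckeRing0.T N 2 p hp • w y) : periodHomologyHecke N) : Module.Dual ℂ (CuspForm (Gamma0 N) 2)) =
      (haveI : NeZero p := ⟨hp.ne_zero⟩;
        (cuspHeckeOperatorₗ (Gamma0 N) 2 (diagGL p 1 (Nat.cast_pos.mpr (NeZero.pos p)) one_pos)).dualMap
          (y : Module.Dual ℂ (CuspForm (Gamma0 N) 2))) := by
  haveI : NeZero p := ⟨hp.ne_zero⟩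
  rw [hw, Submodule.coe_smul, SdTorsion.heckeRing0_T_smul_eq_dualMap, hw, dualMap_transposeHeckeT_eq_frickeConj]

end Transpose

/-! ## §2 One level: a bijective pairing that is transpose-adjoint on the generators gives IP at level `N` -/

section OneLevel

variable {N : ℕ} [NeZero N]

/-- Precomposition with an additive involution `w` of `Λ` is a bijection of `Hom(Λ, ℤ)`. [folklore] -/
theorem bijective_comp_of_involutive (w : periodHomologyHecke N →+ periodHomologyHecke N)
    (hww : ∀ y : periodHomologyHecke N, w (w y) = y) :
    Function.Bijective (fun f : periodHomologyHecke N →+ ℤ ↦ f.comp w) := by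
  have hinv : ∀ f : periodHomologyHecke N →+ ℤ, (f.comp w).comp w = f := fun f ↦
    AddMonoidHom.ext fun y ↦ by rw [AddMonoidHom.comp_apply, AddMonoidHom.comp_apply, hww]
  exact Function.bijective_iff_has_inverse.mpr ⟨fun f ↦ f.comp w, hinv, hinv⟩

/-- **S7 at one level, twisted form.** On `Λ = periodHomologyHecke N`: if `B : Λ → Hom(Λ, ℤ)` is bi-additive and BIJECTIVE, `w : Λ → Λ` is an
additive involution, and for EVERY prime `p` (with `T_p = HeckeRing0.T N 2 p`, `= U_p` when `p ∣ N`) `B (T_p • x) y = B x (w (T_p • (w y)))`,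
then `B' x y := B x (w y)` is bijective and `B' (t • x) y = B' x (t • y)` for every `t ∈ 𝕋_ℤ` — i.e. IP holds at level `N`. (Balancedness
passes from the generators to `𝕋_ℤ = ℤ[T_p]` by `balanced_of_balanced_T`; no hypothesis `w T_p = T_p w` and no `p ∤ N` split is needed.)
[cite: DarmonDiamondTaylor1995, §1.6 Lemma 1.38 (p. 41)] [cite: Merel1995Homologie, §2.1–2.3] -/
theorem exists_perfect_balanced_of_twistedAdjoint
    (B : periodHomologyHecke N →+ (periodHomologyHecke N →+ ℤ)) (hB : Function.Bijective B)
    (w : periodHomologyHecke N →+ periodHomologyHecke N) (hww : ∀ y : periodHomologyHecke N, w (w y) = y)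
    (hAdj : ∀ (p : ℕ) (hp : p.Prime) (x y : periodHomologyHecke N),
      B (HeckeRing0.T N 2 p hp • x) y = B x (w (HeckeRing0.T N 2 p hp • w y))) :
    ∃ B' : periodHomologyHecke N →+ (periodHomologyHecke N →+ ℤ),
      Function.Bijective B' ∧
        ∀ (t : HeckeRing0 N 2) (x y : periodHomologyHecke N), B' (t • x) y = B' x (t • y) := by
  -- the twisted pairing `B'(x, y) = B(x, w y)`
  let B' : periodHomologyHecke N →+ (periodHomologyHecke N →+ ℤ) :=
    AddMonoidHom.mk' (fun x ↦ (B x).comp w) (fun x x' ↦ by rw [B.map_add, AddMonoidHom.add_comp])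
  have hB' : ∀ x y, B' x y = B x (w y) := fun _ _ ↦ rfl
  refine ⟨B', ?_, ?_⟩
  · -- bijective: `B' = (· ∘ w) ∘ B`
    have hfun : (⇑B' : periodHomologyHecke N → (periodHomologyHecke N →+ ℤ)) =
        (fun f : periodHomologyHecke N →+ ℤ ↦ f.comp w) ∘ (⇑B) := rfl
    rw [hfun]
    exact (bijective_comp_of_involutive w hww).comp hB
  · -- balanced on the generators, hence on `𝕋_ℤ`
    have hgen : ∀ (p : ℕ) (hp : p.Prime) (x y : periodHomologyHecke N),
        B' (HeckeRing0.T N 2 p hp • x) y = B' x (HeckeRing0.T N 2 p hp • y) := by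
      intro p hp x y
      rw [hB', hB', hAdj p hp x (w y), hww]
    exact balanced_of_balanced_T B' hgen

/-- **S7 at one level, transpose form** (the hypothesis in the shape the combinatorial bricks HA-T/HA-U deliver): if `B : Λ → Hom(Λ, ℤ)` is
bi-additive and bijective and, for every prime `p` and all `x y y' ∈ Λ` with `y'` the element underlying `[Γ₀(N) diag(p,1) Γ₀(N)]^∨ y`
(which lies in `Λ`, `dualMap_transposeHeckeT_mem_periodHomology`), `B (T_p • x) y = B x y'`, then IP holds at level `N`. The Fricke map
`w = w_N^∨` on `Λ` is supplied internally (`exists_frickeHom_periodHomologyHecke`, w4 g6) and `T♯_p = w T_p w` (`frickeHom_heckeT_frickeHom_coe`).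
[cite: Merel1995Homologie, §1.2–1.3 and §2.1–2.3] [cite: DiamondShurman2005, Ex. 5.5.1] -/
theorem exists_perfect_balanced_of_transposeAdjoint
    (B : periodHomologyHecke N →+ (periodHomologyHecke N →+ ℤ)) (hB : Function.Bijective B)
    (hAdj : ∀ (p : ℕ) (hp : p.Prime) (x y y' : periodHomologyHecke N),
      ((y' : periodHomologyHecke N) : Module.Dual ℂ (CuspForm (Gamma0 N) 2)) =
        (haveI : NeZero p := ⟨hp.ne_zero⟩;
          (cuspHeckeOperatorₗ (Gamma0 N) 2 (diagGL p 1 (Nat.cast_pos.mpr (NeZero.pos p)) one_pos)).dualMap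
            (y : Module.Dual ℂ (CuspForm (Gamma0 N) 2))) →
      B (HeckeRing0.T N 2 p hp • x) y = B x y') :
    ∃ B' : periodHomologyHecke N →+ (periodHomologyHecke N →+ ℤ),
      Function.Bijective B' ∧
        ∀ (t : HeckeRing0 N 2) (x y : periodHomologyHecke N), B' (t • x) y = B' x (t • y) := by
  obtain ⟨w, hw, hww, -⟩ := SdTorsion.exists_frickeHom_periodHomologyHecke N
  exact exists_perfect_balanced_of_twistedAdjoint B hB w hww
    fun p hp x y ↦ hAdj p hp x y _ (frickeHom_heckeT_frickeHom_coe N w hw p hp y)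

/-- **S7 at one level, split form** (the exact-over-`ℤ` version of the hypothesis list of the lead's mod-`2` interface
`sdTwo_of_twistedAdjointPairing`, p653335): `B` bijective; `w` an additive involution of `Λ` commuting with `T_p` for `p ∤ N`;
`B (T_p • x) y = B x (T_p • y)` for primes `p ∤ N` (Merel: `T_p` is self-adjoint) and `B (U_q • x) y = B x (w (U_q • (w y)))` for primes
`q ∣ N` (`U_q† = w U_q w`). Then IP holds at level `N`. [cite: DarmonDiamondTaylor1995, §1.6 Lemma 1.38 (p. 41)] [cite: Merel1995Homologie, §2.1–2.3] -/
theorem exists_perfect_balanced_of_adjoint_T_U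
    (B : periodHomologyHecke N →+ (periodHomologyHecke N →+ ℤ)) (hB : Function.Bijective B)
    (w : periodHomologyHecke N →+ periodHomologyHecke N) (hww : ∀ y : periodHomologyHecke N, w (w y) = y)
    (hTw : ∀ (p : ℕ) (hp : p.Prime), ¬ p ∣ N → ∀ y : periodHomologyHecke N,
      w (HeckeRing0.T N 2 p hp • y) = HeckeRing0.T N 2 p hp • w y)
    (hT : ∀ (p : ℕ) (hp : p.Prime), ¬ p ∣ N → ∀ x y : periodHomologyHecke N,
      B (HeckeRing0.T N 2 p hp • x) y = B x (HeckeRing0.T N 2 p hp • y))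
    (hU : ∀ (q : ℕ) (hq : q.Prime), q ∣ N → ∀ x y : periodHomologyHecke N,
      B (HeckeRing0.T N 2 q hq • x) y = B x (w (HeckeRing0.T N 2 q hq • w y))) :
    ∃ B' : periodHomologyHecke N →+ (periodHomologyHecke N →+ ℤ),
      Function.Bijective B' ∧
        ∀ (t : HeckeRing0 N 2) (x y : periodHomologyHecke N), B' (t • x) y = B' x (t • y) := by
  refine exists_perfect_balanced_of_twistedAdjoint B hB w hww fun p hp x y ↦ ?_
  by_cases hpN : p ∣ N
  · exact hU p hp hpN x y
  · rw [hTw p hp hpN (w y), hww]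
    exact hT p hp hpN x y

/-- **Per-level Hecke self-duality of `J₀(N)[ℓ]` for EVERY prime `ℓ` from IP at level `N`** (Darmon–Diamond–Taylor Lemma 1.38 reduced mod `ℓ`;
the tree's `SocleCosocle.exists_balanced_perfect_pairing_torsionBy` through the Hecke isomorphism `Λ/ℓΛ ≅ J₀(N)[ℓ]`, `J0.exists_linearDivMap`):
a `𝕋_ℤ`-balanced pairing `J₀(N)[ℓ] × J₀(N)[ℓ] → ℤ/ℓ` with trivial left and right kernels — the level-`N` instance of the named fact
`heckeSelfDual_torsionBy_J0`, so consumers that destructure `hSD L ℓ` at one level can be fed level by level.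
[cite: DarmonDiamondTaylor1995, §1.6 Lemma 1.38 (p. 41) and §4.5 (p. 134)] -/
theorem exists_selfDual_torsionBy_of_perfect_balanced
    (hIP : ∃ B : periodHomologyHecke N →+ (periodHomologyHecke N →+ ℤ),
      Function.Bijective B ∧ ∀ (t : HeckeRing0 N 2) (x y : periodHomologyHecke N), B (t • x) y = B x (t • y))
    (ℓ : ℕ) [Fact ℓ.Prime] :
    ∃ Bbar : Submodule.torsionBy (HeckeRing0 N 2) (J0 N) ℓ →+ (Submodule.torsionBy (HeckeRing0 N 2) (J0 N) ℓ →+ ZMod ℓ),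
      (∀ (t : HeckeRing0 N 2) (x y : Submodule.torsionBy (HeckeRing0 N 2) (J0 N) ℓ), Bbar (t • x) y = Bbar x (t • y)) ∧
      (∀ x : Submodule.torsionBy (HeckeRing0 N 2) (J0 N) ℓ, (∀ y, Bbar x y = 0) → x = 0) ∧
      (∀ y : Submodule.torsionBy (HeckeRing0 N 2) (J0 N) ℓ, (∀ x, Bbar x y = 0) → y = 0) := by
  have hℓ : ℓ ≠ 0 := (Fact.out : ℓ.Prime).ne_zero
  haveI := moduleFinite_int_periodHomologyHecke N
  haveI := moduleFree_int_periodHomologyHecke N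
  obtain ⟨B, hB, hadj⟩ := hIP
  obtain ⟨δ, -, hker, hrange⟩ := J0.exists_linearDivMap N hℓ
  exact Literature.Algebra.Module.SocleCosocle.exists_balanced_perfect_pairing_torsionBy B hB hadj ℓ δ hker hrange

end OneLevel

/-! ## §3 All levels: the named fact IP, then SD and Kan⁺ (+ Bz), from transpose-adjointness -/

section AllLevels

/-- **IP BY NAME from transpose-adjointness at every level** (transpose form): if for every `N ≥ 1` some bijective bi-additive `B` on
`Λ = periodHomologyHecke N` satisfies `B (T_p • x) y = B x (T♯_p y)` for all primes `p` (`T♯_p = [Γ₀(N) diag(p,1) Γ₀(N)]^∨`), then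
`periodHomology_exists_heckeSelfAdjoint_perfectPairing`. [cite: Merel1995Homologie, §1.2–1.3 and §2.1–2.3] [cite: DiamondShurman2005, Ex. 5.5.1] -/
theorem ip_of_transposeAdjoint
    (h : ∀ (N : ℕ) [NeZero N], ∃ B : periodHomologyHecke N →+ (periodHomologyHecke N →+ ℤ), Function.Bijective B ∧
      ∀ (p : ℕ) (hp : p.Prime) (x y y' : periodHomologyHecke N),
        ((y' : periodHomologyHecke N) : Module.Dual ℂ (CuspForm (Gamma0 N) 2)) =
          (haveI : NeZero p := ⟨hp.ne_zero⟩;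
            (cuspHeckeOperatorₗ (Gamma0 N) 2 (diagGL p 1 (Nat.cast_pos.mpr (NeZero.pos p)) one_pos)).dualMap
              (y : Module.Dual ℂ (CuspForm (Gamma0 N) 2))) →
        B (HeckeRing0.T N 2 p hp • x) y = B x y') :
    periodHomology_exists_heckeSelfAdjoint_perfectPairing := by
  intro N _
  obtain ⟨B, hB, hAdj⟩ := h N
  exact exists_perfect_balanced_of_transposeAdjoint B hB hAdj

/-- **IP BY NAME from twisted adjointness at every level** (twisted form, `w` any additive involution of `Λ`):
`B (T_p • x) y = B x (w (T_p • (w y)))` for all primes with `B` bijective ⟹ `periodHomology_exists_heckeSelfAdjoint_perfectPairing`.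
[cite: DarmonDiamondTaylor1995, §1.6 Lemma 1.38 (p. 41)] [cite: Merel1995Homologie, §2.1–2.3] -/
theorem ip_of_twistedAdjoint
    (h : ∀ (N : ℕ) [NeZero N], ∃ (B : periodHomologyHecke N →+ (periodHomologyHecke N →+ ℤ))
      (w : periodHomologyHecke N →+ periodHomologyHecke N), Function.Bijective B ∧ (∀ y, w (w y) = y) ∧
      ∀ (p : ℕ) (hp : p.Prime) (x y : periodHomologyHecke N),
        B (HeckeRing0.T N 2 p hp • x) y = B x (w (HeckeRing0.T N 2 p hp • w y))) :
    periodHomology_exists_heckeSelfAdjoint_perfectPairing := by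
  intro N _
  obtain ⟨B, w, hB, hww, hAdj⟩ := h N
  exact exists_perfect_balanced_of_twistedAdjoint B hB w hww hAdj

open scoped Classical in
/-- **IP BY NAME from the Hecke clause OF THE CROSSING PAIRING** — the literal output shape of bricks HA-T/HA-U of
`Lines/birth-sd2-hecke-adjoint.md`: if at every level EVERY bi-additive `B` on `Λ` satisfying rtt-p3-w2 g8's crossing formula
(`B {∞, γ∞} {∞, γ'∞}` = signed crossing count of a dual chain of `γ` with a Manin chain of `γ'`, hypothesis copied verbatim from
`exists_perfect_crossingPairing_hecke`) is transpose-adjoint on the generators, then IP (the bijective such `B` exists by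
`exists_perfect_crossingPairing_hecke`, p654816; `Classical` decidability on `Gamma0Coset N` as there).
[cite: Merel1995Homologie, §1.2–1.3 and §2.1–2.3] [cite: Manin1972, Thm. 1.9] -/
theorem ip_of_crossingPairing_transposeAdjoint
    (hHA : ∀ (N : ℕ) [NeZero N] (B : periodHomologyHecke N →+ (periodHomologyHecke N →+ ℤ)),
      (∀ (γ γ' : Gamma0 N) (D L : List SL(2, ℤ)),
        (∀ {A : Type} [AddCommGroup A] (G : SL(2, ℤ) → A), (∀ x, G (x * (S * T⁻¹)) = G x) → (∀ x, G (-x) = G x) →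
          (D.map fun h ↦ G h - G (h * S)).sum = G (γ : SL(2, ℤ)) - G 1) →
        (∀ {A : Type} [AddCommGroup A] (F : SL(2, ℤ) → A), (∀ g, F (g * T) = F g) → (∀ g, F (-g) = F g) →
          (L.map fun g ↦ F g - F (g * S)).sum = F (γ' : SL(2, ℤ)) - F 1) →
        B ⟨periodFunctional N γ, (mem_periodHomologyHecke N).mpr (periodFunctional_mem_periodHomology N γ)⟩
          ⟨periodFunctional N γ', (mem_periodHomologyHecke N).mpr (periodFunctional_mem_periodHomology N γ')⟩ =
          (L.map fun g ↦ (D.map fun h ↦ (Pi.single ((h⁻¹ : SL(2, ℤ)) : Gamma0Coset N) (1 : ℤ) -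
            Pi.single (((h * S)⁻¹ : SL(2, ℤ)) : Gamma0Coset N) 1 : Gamma0Coset N → ℤ)).sum ((g⁻¹ : SL(2, ℤ)) : Gamma0Coset N)).sum) →
      ∀ (p : ℕ) (hp : p.Prime) (x y y' : periodHomologyHecke N),
        ((y' : periodHomologyHecke N) : Module.Dual ℂ (CuspForm (Gamma0 N) 2)) =
          (haveI : NeZero p := ⟨hp.ne_zero⟩;
            (cuspHeckeOperatorₗ (Gamma0 N) 2 (diagGL p 1 (Nat.cast_pos.mpr (NeZero.pos p)) one_pos)).dualMap
              (y : Module.Dual ℂ (CuspForm (Gamma0 N) 2))) →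
        B (HeckeRing0.T N 2 p hp • x) y = B x y') :
    periodHomology_exists_heckeSelfAdjoint_perfectPairing := by
  intro N _
  obtain ⟨B, hB, hcross⟩ := exists_perfect_crossingPairing_hecke (N := N)
  exact exists_perfect_balanced_of_transposeAdjoint B hB (hHA N B hcross)

/-- **SD BY NAME (`heckeSelfDual_torsionBy_J0`, item 27800's fact, all `N` and all primes `ℓ`) from transpose-adjointness at every level**
(IP by `ip_of_transposeAdjoint`, then the tree's `heckeSelfDual_torsionBy_J0_of_perfectPairing`).
[cite: DarmonDiamondTaylor1995, §1.6 Lemma 1.38 (p. 41) and §4.5 (p. 134)] [cite: Merel1995Homologie, §2.1–2.3] -/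
theorem heckeSelfDual_of_transposeAdjoint
    (h : ∀ (N : ℕ) [NeZero N], ∃ B : periodHomologyHecke N →+ (periodHomologyHecke N →+ ℤ), Function.Bijective B ∧
      ∀ (p : ℕ) (hp : p.Prime) (x y y' : periodHomologyHecke N),
        ((y' : periodHomologyHecke N) : Module.Dual ℂ (CuspForm (Gamma0 N) 2)) =
          (haveI : NeZero p := ⟨hp.ne_zero⟩;
            (cuspHeckeOperatorₗ (Gamma0 N) 2 (diagGL p 1 (Nat.cast_pos.mpr (NeZero.pos p)) one_pos)).dualMap
              (y : Module.Dual ℂ (CuspForm (Gamma0 N) 2))) →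
        B (HeckeRing0.T N 2 p hp • x) y = B x y') :
    heckeSelfDual_torsionBy_J0 :=
  heckeSelfDual_torsionBy_J0_of_perfectPairing (ip_of_transposeAdjoint h)

/-- **Kan⁺ `ThetaLayerLambdaCongruenceAtTwo` BY NAME from transpose-adjointness at every level + Buzzard 2000 Prop. 2.4** — the kernel road's
end state under TODAY's typing of the one Buzzard fact: once the Hecke clause of the crossing pairing is a theorem, the crux is conditional on
Bz ALONE (`thetaLayerLambdaCongruenceAtTwo_of_ipBz`, p644762 lineage). CONDITIONAL on both displayed hypotheses; BSD is not proved by this.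
[cite: Buzzard2000LevelLoweringModTwo, Prop. 2.4] [cite: DarmonDiamondTaylor1995, §1.6 Lemma 1.38 and §4.5] [cite: Merel1995Homologie, §2.1–2.3]
[cite: Pollack2003, Prop. 6.18 (shape)] -/
theorem thetaLayerLambdaCongruenceAtTwo_of_transposeAdjoint_bz
    (h : ∀ (N : ℕ) [NeZero N], ∃ B : periodHomologyHecke N →+ (periodHomologyHecke N →+ ℤ), Function.Bijective B ∧
      ∀ (p : ℕ) (hp : p.Prime) (x y y' : periodHomologyHecke N),
        ((y' : periodHomologyHecke N) : Module.Dual ℂ (CuspForm (Gamma0 N) 2)) =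
          (haveI : NeZero p := ⟨hp.ne_zero⟩;
            (cuspHeckeOperatorₗ (Gamma0 N) 2 (diagGL p 1 (Nat.cast_pos.mpr (NeZero.pos p)) one_pos)).dualMap
              (y : Module.Dual ℂ (CuspForm (Gamma0 N) 2))) →
        B (HeckeRing0.T N 2 p hp • x) y = B x y')
    (hBz : buzzard2000_multiplicityOne_gamma0) :
    ThetaLayerLambdaCongruenceAtTwo :=
  thetaLayerLambdaCongruenceAtTwo_of_ipBz (ip_of_transposeAdjoint h) hBz

/-- **Kan⁺ BY NAME from twisted adjointness at every level + Bz** (twisted form of the previous theorem). CONDITIONAL; BSD is not proved by this.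
[cite: Buzzard2000LevelLoweringModTwo, Prop. 2.4] [cite: DarmonDiamondTaylor1995, §1.6 Lemma 1.38 and §4.5] [cite: Pollack2003, Prop. 6.18 (shape)] -/
theorem thetaLayerLambdaCongruenceAtTwo_of_twistedAdjoint_bz
    (h : ∀ (N : ℕ) [NeZero N], ∃ (B : periodHomologyHecke N →+ (periodHomologyHecke N →+ ℤ))
      (w : periodHomologyHecke N →+ periodHomologyHecke N), Function.Bijective B ∧ (∀ y, w (w y) = y) ∧
      ∀ (p : ℕ) (hp : p.Prime) (x y : periodHomologyHecke N),
        B (HeckeRing0.T N 2 p hp • x) y = B x (w (HeckeRing0.T N 2 p hp • w y)))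
    (hBz : buzzard2000_multiplicityOne_gamma0) :
    ThetaLayerLambdaCongruenceAtTwo :=
  thetaLayerLambdaCongruenceAtTwo_of_ipBz (ip_of_twistedAdjoint h) hBz

end AllLevels

end Summit.BirchSwinnertonDyer.BirchSwinnertonDyer.Theorems.ThetaLayerLambdaCongruenceAtTwo

end
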